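import Literature.NumberTheory.Automorphic.RankOneOrbitCell
import HarnessLib

/-!
# The orbit of the highest weight line in semisimple rank one, III: the Bruhat decomposition
(trunk T-AUTOMORPHIC, G25 AutomorphicL; Springer 7.1.5, 7.2.2 (i) on `k`-points)

Conclusion of `RankOneOrbit.lean` / `RankOneOrbitCell.lean`. From the data `RankOneOrbitData`
(representation `ρ` of 5.5.3 with line stabiliser `B = T · U_α`, `ρ(T)` diagonal, closed orbit
cone `C`, Weyl element `m`, `z₀ = ρ(m) v`) we prove, all sorry-free:

* `slice` — the affine slice `A = {w ∈ C | w(i₀) = z₀(i₀)}` (`i₀` in the support of `z₀`), a copy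
  of `X ∖ {x₀}`, `X = G · [v]`; `isClosed_slice`; **`finite_fibre`**: the top coordinate `w(j₀)`
  has finite fibres on `A` (finiteness lemma `IsConeSet.finite_sep_dotProduct_eq_one` and the
  chart `exists_low_coords`); **`isIrreducible_slice`** (image of the open subset
  `{(ρ(g) v)(i₀) ≠ 0}` of the irreducible `G` under a rational map whose pulled-back equations are
  polynomial);
* `isClosed_range_polyCurve` — the image of a non-constant polynomial curve in `kᴺ` is closed
  (elimination theorem `isClosed_setOf_exists_common_zero`, Springer 6.1.3);
* `orbitCurve y = ρ(u(y)) z₀`: injective, inside the slice, closed image, and the top coordinate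
  takes infinitely many values on it (`exists_high_coords`);
* **`range_orbitCurve_eq_slice`** (`X ∖ {x₀} = U · x_∞`, by the curve criterion
  `AffineCurveCriterion.eq_of_isClosed_of_infinite_image`) and **`RankOneOrbitData.bruhat`**:
  every `g ∈ G ∖ B` is `u(x) m t u(y)` (Springer 7.2.2 (i): "*`G` is the disjoint union of `B` and
  `U n B`*");
* `exists_rankOneOrbitData` — the data exist given `Z_G(T) = T` (`centralizer_eq_of_isMaximalTorusIn`,
  7.6.4 (ii)), the closed-orbit fact `isClosed_orbitCone_of_borel_le_lineStabilizer` (6.2.7 (ii)),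
  a root homomorphism `u` with `T · U_α` Borel and `m ∈ N_G(T) ∖ Z_G(T)` (Chevalley 5.5.3
  `exists_isAlgebraicGL_lineStabilizer_eq` + `exists_conj_le_diagonalSubgroup`); whence
  **`bruhat_of_isBorelIn`**, the Bruhat decomposition in semisimple rank one from these two facts.

## References

* [SpringerLAG1998] T. A. Springer, *Linear Algebraic Groups*, 2nd ed. (1998): 5.5.3, 6.1.2–6.1.3,
  6.2.7, 7.1.5, 7.2.2, 7.6.4.
-/

open scoped MatrixGroups IsMulCommutative
open Matrix

namespace Literature.NumberTheory.Automorphic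

variable {k : Type*} [Field k] {n : Type*} [Fintype n] [DecidableEq n]

attribute [local instance] zariskiTopologyPi

/-! ### The affine slice through `z₀` and its finite fibres -/

section Slice

namespace RankOneOrbitData

variable {G T : Subgroup (GL n k)} {α : ↥(characterLattice T)} {u : Multiplicative k →* ↥G}
  {m : GL n k} {N : ℕ} {ρ : ↥G →* GL (Fin N) k} {v : Fin N → k}
variable (h : RankOneOrbitData G T α u m ρ v)
include h

/-- A coordinate `i₀` in the support of `z₀`. [folklore] -/
noncomputable def i0 : Fin N := (Function.ne_iff.1 h.z0_ne_zero).choose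

/-- `z₀(i₀) ≠ 0`. [folklore] -/
theorem z0_i0 : h.z0 h.i0 ≠ 0 := fun h0 =>
  (Function.ne_iff.1 h.z0_ne_zero).choose_spec (by rw [Pi.zero_apply]; exact h0)

/-- A coordinate `j₀` in the support of `v`. [folklore] -/
noncomputable def j0 : Fin N := (Function.ne_iff.1 h.ne_zero).choose

/-- `v(j₀) ≠ 0`. [folklore] -/
theorem v_j0 : v h.j0 ≠ 0 := fun h0 =>
  (Function.ne_iff.1 h.ne_zero).choose_spec (by rw [Pi.zero_apply]; exact h0)

/-- **The affine slice** `A = {w ∈ C | w(i₀) = z₀(i₀)}` of the orbit cone: a copy of the open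
subset `Ω_∞ ∩ X = X ∖ {x₀}` of `X = G · [v]` (Springer 7.1.5's affine chart at `y_∞`).
[cite: SpringerLAG1998, 7.1.5 (proof)] -/
def slice : Set (Fin N → k) := {w | w ∈ orbitCone ρ.range v ∧ w h.i0 = h.z0 h.i0}

/-- Membership in the slice. [folklore] -/
theorem mem_slice_iff {w : Fin N → k} : w ∈ h.slice ↔ w ∈ orbitCone ρ.range v ∧ w h.i0 = h.z0 h.i0 :=
  Iff.rfl

/-- The slice is closed. [folklore] -/
theorem isClosed_slice : IsClosed h.slice := by
  have h1 : IsClosed {w : Fin N → k | MvPolynomial.eval w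
      (MvPolynomial.X h.i0 - MvPolynomial.C (h.z0 h.i0)) = 0} := isClosed_setOf_eval_eq_zero _
  convert h.closed.inter h1 using 1
  ext w
  simp [slice, sub_eq_zero]

/-- `z₀` lies in the slice. [folklore] -/
theorem z0_mem_slice : h.z0 ∈ h.slice := ⟨h.z0_mem, rfl⟩

/-- Points of the slice are non-zero and are not multiples of `v`: a multiple `c v` in the slice
would have `c v(i₀) = z₀(i₀) ≠ 0`, but `v(i₀) = 0` since `i₀` has weight `M_∞ ≠ M₀`. [folklore] -/
theorem not_smul_v_of_mem_slice [IsAlgClosed k] {w : Fin N → k} (hw : w ∈ h.slice) :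
    w ≠ 0 ∧ ¬ ∃ c : k, w = c • v := by
  haveI : IsMulCommutative ↥T := h.torus.2.1
  obtain ⟨γ, hd⟩ := h.exists_cochar_pos
  have hvi : v h.i0 = 0 := by
    by_contra hvi
    have e1 := h.wtInt_eq_Mv (γ := γ) hvi
    have e2 := h.wtInt_eq_Mz (γ := γ) h.z0_i0
    exact absurd (e1.symm.trans e2) (ne_of_gt (h.Mz_lt_Mv hd))
  constructor
  · intro h0
    have := hw.2
    rw [h0] at this
    exact h.z0_i0 this.symm
  · rintro ⟨c, rfl⟩
    have := hw.2
    rw [Pi.smul_apply, hvi, smul_zero] at this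
    exact h.z0_i0 this.symm

/-- **The fibres of the top coordinate `w ↦ w(j₀)` on the slice are finite** (finiteness lemma
`IsConeSet.finite_sep_dotProduct_eq_one` for the closed cone `C ∩ {z₀(i₀) w(j₀) = c w(i₀)}`, which
meets `w(i₀) = 0` only in `0` by the chart `exists_low_coords`). [cite: SpringerLAG1998, 6.1.2 (vi)] -/
theorem finite_fibre [IsAlgClosed k] (c : k) : {w ∈ h.slice | w h.j0 = c}.Finite := by
  classical
  haveI : IsMulCommutative ↥T := h.torus.2.1
  obtain ⟨γ, hd⟩ := h.exists_cochar_pos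
  set D : Set (Fin N → k) := {w | w ∈ orbitCone ρ.range v ∧ h.z0 h.i0 * w h.j0 = c * w h.i0}
    with hD
  have hDcone : IsConeSet D := by
    intro a _ w hw
    refine ⟨isConeSet_orbitCone a ‹_› w hw.1, ?_⟩
    simp only [Pi.smul_apply, smul_eq_mul]
    rw [mul_left_comm, hw.2, mul_left_comm]
  have hDcl : IsClosed D := by
    have h1 : IsClosed {w : Fin N → k | MvPolynomial.eval w
        (MvPolynomial.C (h.z0 h.i0) * MvPolynomial.X h.j0 - MvPolynomial.C c * MvPolynomial.X h.i0) = 0} :=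
      isClosed_setOf_eval_eq_zero _
    convert h.closed.inter h1 using 1
    ext w
    simp [hD, sub_eq_zero]
  set a : Fin N → k := Pi.single h.i0 (h.z0 h.i0)⁻¹ with ha
  have hadot : ∀ w : Fin N → k, a ⬝ᵥ w = (h.z0 h.i0)⁻¹ * w h.i0 := fun w => by
    rw [ha, single_dotProduct]
  have hker : ∀ w ∈ D, a ⬝ᵥ w = 0 → w = 0 := by
    intro w hw h0
    rw [hadot, mul_eq_zero, inv_eq_zero] at h0
    have hwi : w h.i0 = 0 := h0.resolve_left h.z0_i0
    by_contra hw0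
    have hnv : ¬ ∃ c' : k, w = c' • v := by
      rintro ⟨c', rfl⟩
      have h2 := hw.2
      rw [hwi, mul_zero, Pi.smul_apply, smul_eq_mul, mul_eq_zero, mul_eq_zero] at h2
      rcases h2 with h2 | h2 | h2
      · exact h.z0_i0 h2
      · apply hw0; rw [h2, zero_smul]
      · exact h.v_j0 h2
    obtain ⟨c', hc', hlow⟩ := h.exists_low_coords hd hw.1 hw0 hnv
    have := hlow h.i0 (h.wtInt_eq_Mz h.z0_i0)
    rw [hwi] at this
    exact mul_ne_zero hc' h.z0_i0 this.symm
  refine (hDcone.finite_sep_dotProduct_eq_one hDcl a hker).subset ?_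
  rintro w ⟨⟨hwC, hwi⟩, hwj⟩
  refine ⟨⟨hwC, ?_⟩, ?_⟩
  · rw [hwj, hwi, mul_comm]
  · rw [hadot, hwi, inv_mul_cancel₀ h.z0_i0]

/-! #### Irreducibility of the slice -/

/-- The orbit map in coordinates: polynomials `Qᵢ` with `Qᵢ(g) = (ρ(g) v)ᵢ` for `g ∈ G`. [folklore] -/
theorem exists_poly_orbit :
    ∃ Q : Fin N → MvPolynomial (GLCoord n) k, ∀ (g : ↥G) (i : Fin N),
      MvPolynomial.eval (glCoordFun (g : GL n k)) (Q i) =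
        (((ρ g : GL (Fin N) k) : Matrix (Fin N) (Fin N) k) *ᵥ v) i := by
  obtain ⟨P, hP⟩ := h.algebraic
  refine ⟨fun i => ∑ j, P (Sum.inl (i, j)) * MvPolynomial.C (v j), fun g i => ?_⟩
  rw [map_sum, Matrix.mulVec, dotProduct]
  refine Finset.sum_congr rfl fun j _ => ?_
  rw [map_mul, MvPolynomial.eval_C, ← hP, glCoordFun_inl]

attribute [local instance] zariskiTopologyGL

/-- **The slice is irreducible.** It is the image of the open subset `G⁰ = {g ∈ G | (ρ(g) v)(i₀) ≠ 0}`
of the irreducible `G` under the rational map `φ(g) = (z₀(i₀)/(ρ(g) v)(i₀)) ρ(g) v`; the preimage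
of a closed `Z ⊆ kᴺ` under `φ` is cut out in `G⁰` by polynomials (clear denominators degree by
degree), so `φ(G⁰) ⊆ Z₁ ∪ Z₂` forces `G⁰ ⊆ φ⁻¹ Z₁` or `G⁰ ⊆ φ⁻¹ Z₂` (Springer 1.3.7 (ii):
an open subset of an irreducible variety is irreducible, and images of irreducibles).
[cite: SpringerLAG1998, 1.2.3] -/
theorem isIrreducible_slice [IsAlgClosed k] : IsIrreducible h.slice := by
  classical
  obtain ⟨Q, hQ⟩ := h.exists_poly_orbit
  set a : k := h.z0 h.i0 with ha
  have ha0 : a ≠ 0 := h.z0_i0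
  -- `G⁰`
  set U0 : Set (GL n k) := {x | MvPolynomial.eval (glCoordFun x) (Q h.i0) ≠ 0} with hU0
  have hU0open : IsOpen U0 := by
    have : U0 = (zeroLocusGL {Q h.i0})ᶜ := by
      ext x; simp [hU0, zeroLocusGL]
    rw [this]
    exact (isClosed_zeroLocusGL _).isOpen_compl
  have hG0irr : IsIrreducible (U0 ∩ (G : Set (GL n k))) := by
    refine isIrreducible_isOpen_inter h.conn.isIrreducible hU0open ⟨m, ?_, h.memG⟩
    show MvPolynomial.eval (glCoordFun ((⟨m, h.memG⟩ : ↥G) : GL n k)) (Q h.i0) ≠ 0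
    rw [hQ]
    exact ha0
  -- pulled-back polynomials: `p̃(g) = F(g)^D p(φ(g))` for `g ∈ G⁰`
  let pull : MvPolynomial (Fin N) k → MvPolynomial (GLCoord n) k := fun p =>
    ∑ d ∈ Finset.range (p.totalDegree + 1), MvPolynomial.C (a ^ d) * Q h.i0 ^ (p.totalDegree - d) *
      MvPolynomial.bind₁ Q (MvPolynomial.homogeneousComponent d p)
  have hpull : ∀ (p : MvPolynomial (Fin N) k) (g : ↥G),
      MvPolynomial.eval (glCoordFun (g : GL n k)) (Q h.i0) ≠ 0 →
      MvPolynomial.eval (glCoordFun (g : GL n k)) (pull p) =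
        MvPolynomial.eval (glCoordFun (g : GL n k)) (Q h.i0) ^ p.totalDegree *
          MvPolynomial.eval ((a / MvPolynomial.eval (glCoordFun (g : GL n k)) (Q h.i0)) •
            (((ρ g : GL (Fin N) k) : Matrix (Fin N) (Fin N) k) *ᵥ v)) p := by
    intro p g hF
    set F := MvPolynomial.eval (glCoordFun (g : GL n k)) (Q h.i0) with hFdef
    have hw : (fun i => MvPolynomial.eval (glCoordFun (g : GL n k)) (Q i)) =
        ((ρ g : GL (Fin N) k) : Matrix (Fin N) (Fin N) k) *ᵥ v := funext (hQ g)
    set w := (a / F) • (((ρ g : GL (Fin N) k) : Matrix (Fin N) (Fin N) k) *ᵥ v) with hwdef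
    have hsum : MvPolynomial.eval w p = ∑ d ∈ Finset.range (p.totalDegree + 1),
        MvPolynomial.eval w (MvPolynomial.homogeneousComponent d p) := by
      conv_lhs => rw [← MvPolynomial.sum_homogeneousComponent p]
      rw [map_sum]
    rw [hsum, Finset.mul_sum, map_sum]
    refine Finset.sum_congr rfl fun d hd => ?_
    rw [map_mul, map_mul, MvPolynomial.eval_C, map_pow, eval_bind₁', hw, hwdef,
      eval_smul_of_isHomogeneous (MvPolynomial.homogeneousComponent_isHomogeneous d p), ← hFdef]
    have hdle : d ≤ p.totalDegree := Nat.lt_succ_iff.1 (Finset.mem_range.1 hd)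
    obtain ⟨e, he⟩ := Nat.exists_eq_add_of_le hdle
    rw [he, Nat.add_sub_cancel_left, pow_add, div_pow]
    field_simp
  -- the irreducibility criterion
  refine ⟨⟨h.z0, h.z0_mem_slice⟩, isPreirreducible_iff_isClosed_union_isClosed.2 ?_⟩
  intro Z₁ Z₂ hZ₁ hZ₂ hsub
  obtain ⟨S₁, hS₁⟩ := isClosed_iff_exists_setOf_eval.1 hZ₁
  obtain ⟨S₂, hS₂⟩ := isClosed_iff_exists_setOf_eval.1 hZ₂
  set V₁ : Set (GL n k) := zeroLocusGL (pull '' S₁) with hV₁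
  set V₂ : Set (GL n k) := zeroLocusGL (pull '' S₂) with hV₂
  -- `φ(g)` for `g ∈ G⁰` lies in the slice
  have hφ : ∀ g : ↥G, MvPolynomial.eval (glCoordFun (g : GL n k)) (Q h.i0) ≠ 0 →
      (a / MvPolynomial.eval (glCoordFun (g : GL n k)) (Q h.i0)) •
        (((ρ g : GL (Fin N) k) : Matrix (Fin N) (Fin N) k) *ᵥ v) ∈ h.slice := by
    intro g hF
    refine ⟨⟨_, _, ⟨g, rfl⟩, rfl⟩, ?_⟩
    rw [Pi.smul_apply, smul_eq_mul, ← hQ g h.i0, div_mul_cancel₀ _ hF]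
  have hG0sub : U0 ∩ (G : Set (GL n k)) ⊆ V₁ ∪ V₂ := by
    rintro x ⟨hxU, hxG⟩
    have hF : MvPolynomial.eval (glCoordFun ((⟨x, hxG⟩ : ↥G) : GL n k)) (Q h.i0) ≠ 0 := hxU
    rcases hsub (hφ ⟨x, hxG⟩ hF) with hz | hz
    · left
      rintro _ ⟨p, hp, rfl⟩
      rw [show x = ((⟨x, hxG⟩ : ↥G) : GL n k) from rfl, hpull p ⟨x, hxG⟩ hF]
      rw [hS₁] at hz
      rw [hz p hp, mul_zero]
    · right
      rintro _ ⟨p, hp, rfl⟩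
      rw [show x = ((⟨x, hxG⟩ : ↥G) : GL n k) from rfl, hpull p ⟨x, hxG⟩ hF]
      rw [hS₂] at hz
      rw [hz p hp, mul_zero]
  -- from `G⁰ ⊆ V_l` to `slice ⊆ Z_l`
  have key : ∀ {S : Set (MvPolynomial (Fin N) k)} {Z : Set (Fin N → k)},
      Z = {x | ∀ p ∈ S, MvPolynomial.eval x p = 0} →
      U0 ∩ (G : Set (GL n k)) ⊆ zeroLocusGL (pull '' S) → h.slice ⊆ Z := by
    intro S Z hS hGV w hw
    obtain ⟨⟨c, _, ⟨g, rfl⟩, rfl⟩, hwi⟩ := hw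
    rw [Pi.smul_apply, smul_eq_mul] at hwi
    have hF : MvPolynomial.eval (glCoordFun (g : GL n k)) (Q h.i0) ≠ 0 := by
      rw [hQ]
      intro h0
      rw [h0, mul_zero] at hwi
      exact ha0 hwi.symm
    have hc : c = a / MvPolynomial.eval (glCoordFun (g : GL n k)) (Q h.i0) := by
      rw [eq_div_iff hF, hQ, hwi]
    have hgV := hGV ⟨hF, g.2⟩
    rw [hS]
    intro p hp
    have h1 := hgV (pull p) ⟨p, hp, rfl⟩
    rw [hpull p g hF, mul_eq_zero] at h1
    rcases h1 with h1 | h1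
    · exact absurd (pow_eq_zero_iff'.1 h1).1 hF
    · rw [hc]; exact h1
  rcases isPreirreducible_iff_isClosed_union_isClosed.1 hG0irr.2 V₁ V₂ (isClosed_zeroLocusGL _)
    (isClosed_zeroLocusGL _) hG0sub with hV | hV
  · exact Or.inl (key hS₁ hV)
  · exact Or.inr (key hS₂ hV)

end RankOneOrbitData

end Slice

/-! ### Polynomial curves have closed image -/

section Curve

/-- **The image of a non-constant polynomial curve `y ↦ (q₁(y), …, q_N(y))` in `kᴺ` is Zariski
closed** (`k` algebraically closed): `w` is in the image iff the `X`-homogeneous equations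
`x₀^D qᵢ(x₁/x₀) = wᵢ x₀^D` (`D = max deg qᵢ ≥ 1`) have a common zero `(x₀ : x₁) ≠ 0` — at
`x₀ = 0` there is none since some `qᵢ` has degree exactly `D` — so the elimination theorem
`isClosed_setOf_exists_common_zero` (Springer 6.1.3 on `k`-points) applies. [folklore] -/
theorem isClosed_range_polyCurve [IsAlgClosed k] {N : ℕ} (q : Fin N → Polynomial k)
    (hq : ∃ i, 0 < (q i).natDegree) :
    IsClosed (Set.range fun y : k => fun i => (q i).eval y) := by
  classical
  set D : ℕ := Finset.univ.sup fun i => (q i).natDegree with hD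
  have hDle : ∀ i, (q i).natDegree ≤ D := fun i => Finset.le_sup (f := fun i => (q i).natDegree)
    (Finset.mem_univ i)
  obtain ⟨i₁, hi₁⟩ : ∃ i, (q i).natDegree = D := by
    obtain ⟨i, -, hi⟩ := Finset.exists_mem_eq_sup (Finset.univ : Finset (Fin N))
      (hq.elim fun i _ => ⟨i, Finset.mem_univ i⟩) fun i => (q i).natDegree
    exact ⟨i, hi.symm⟩
  have hDpos : 0 < D := by obtain ⟨i, hi⟩ := hq; exact lt_of_lt_of_le hi (hDle i)
  -- the homogeneous equations
  let f : Fin N → MvPolynomial (Fin 2) (MvPolynomial (Fin N) k) := fun i =>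
    ∑ e ∈ Finset.range (D + 1), MvPolynomial.C (MvPolynomial.C ((q i).coeff e)) *
      MvPolynomial.X 1 ^ e * MvPolynomial.X 0 ^ (D - e) -
      MvPolynomial.C (MvPolynomial.X i) * MvPolynomial.X 0 ^ D
  have hf : ∀ i, (f i).IsHomogeneous D := by
    intro i
    refine MvPolynomial.IsHomogeneous.sub (MvPolynomial.IsHomogeneous.sum _ _ _ fun e he => ?_) ?_
    · have hle : e ≤ D := Nat.lt_succ_iff.1 (Finset.mem_range.1 he)
      have h1 := ((MvPolynomial.isHomogeneous_C (Fin 2) (MvPolynomial.C ((q i).coeff e))).mul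
        (MvPolynomial.isHomogeneous_X_pow (1 : Fin 2) e)).mul
        (MvPolynomial.isHomogeneous_X_pow (R := MvPolynomial (Fin N) k) (0 : Fin 2) (D - e))
      rwa [zero_add, Nat.add_sub_cancel' hle] at h1
    · have h1 := (MvPolynomial.isHomogeneous_C (Fin 2) (MvPolynomial.X (R := k) i)).mul
        (MvPolynomial.isHomogeneous_X_pow (R := MvPolynomial (Fin N) k) (0 : Fin 2) D)
      rwa [zero_add] at h1
  have heval : ∀ (w : Fin N → k) (x : Fin 2 → k) (i : Fin N),
      MvPolynomial.eval x (specialize w (f i)) =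
        ∑ e ∈ Finset.range (D + 1), (q i).coeff e * x 1 ^ e * x 0 ^ (D - e) - w i * x 0 ^ D := by
    intro w x i
    simp [f, specialize]
  have hclosed := isClosed_setOf_exists_common_zero (k := k) f hf
  convert hclosed using 1
  ext w
  simp only [Set.mem_range, Set.mem_setOf_eq, heval]
  constructor
  · rintro ⟨y, rfl⟩
    refine ⟨![1, y], fun h0 => one_ne_zero (congrFun h0 0), fun i => ?_⟩
    simp only [Matrix.cons_val_one, Matrix.cons_val_zero, one_pow, mul_one,
      Matrix.cons_val_fin_one]
    rw [sub_eq_zero, Polynomial.eval_eq_sum_range' (Nat.lt_succ_of_le (hDle i))]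
  · rintro ⟨x, hx0, hx⟩
    by_cases h0 : x 0 = 0
    · -- no common zero at infinity
      exfalso
      have h1 : x 1 ≠ 0 := by
        intro h1; apply hx0; funext j; fin_cases j <;> assumption
      have := hx i₁
      rw [h0, zero_pow hDpos.ne', mul_zero, sub_zero, Finset.sum_eq_single D] at this
      · rw [Nat.sub_self, pow_zero, mul_one, mul_eq_zero] at this
        rcases this with h2 | h2
        · have hq0 : q i₁ ≠ 0 := by
            intro hq0; rw [hq0, Polynomial.natDegree_zero] at hi₁; omega
          rw [← hi₁, Polynomial.coeff_natDegree, Polynomial.leadingCoeff_eq_zero] at h2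
          exact hq0 h2
        · exact h1 (pow_eq_zero_iff'.1 h2).1
      · intro e he hne
        have hlt : e < D := lt_of_le_of_ne (Nat.lt_succ_iff.1 (Finset.mem_range.1 he)) hne
        rw [zero_pow (Nat.sub_ne_zero_of_lt hlt), mul_zero]
      · intro hD'; exact absurd (Finset.mem_range.2 (Nat.lt_succ_self D)) hD'
    · refine ⟨x 1 / x 0, funext fun i => ?_⟩
      have := hx i
      rw [sub_eq_zero] at this
      have hxD : x 0 ^ D ≠ 0 := pow_ne_zero _ h0
      apply mul_right_cancel₀ hxD
      rw [← this, Polynomial.eval_eq_sum_range' (Nat.lt_succ_of_le (hDle i)), Finset.sum_mul]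
      refine Finset.sum_congr rfl fun e he => ?_
      have hle : e ≤ D := Nat.lt_succ_iff.1 (Finset.mem_range.1 he)
      rw [div_pow, mul_assoc, mul_assoc]
      congr 1
      field_simp
      rw [mul_assoc, ← pow_add, Nat.add_sub_cancel' hle]

end Curve

/-! ### The curve `U · z₀` fills the slice; the Bruhat decomposition -/

section Bruhat

namespace RankOneOrbitData

variable {G T : Subgroup (GL n k)} {α : ↥(characterLattice T)} {u : Multiplicative k →* ↥G}
  {m : GL n k} {N : ℕ} {ρ : ↥G →* GL (Fin N) k} {v : Fin N → k}
variable (h : RankOneOrbitData G T α u m ρ v)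
include h

/-- The orbit curve `y ↦ ρ(u(y)) z₀` (Springer: `U n x₀ ⊂ G/B`). [cite: SpringerLAG1998, 7.2.2 (proof)] -/
noncomputable def orbitCurve (y : k) : Fin N → k :=
  ((ρ (u (Multiplicative.ofAdd y)) : GL (Fin N) k) : Matrix (Fin N) (Fin N) k) *ᵥ h.z0

/-- The orbit curve is injective (`ρ(u(y - y')) z₀ = z₀ ⇒ y = y'`). [folklore] -/
theorem orbitCurve_injective [IsAlgClosed k] : Function.Injective h.orbitCurve := by
  intro y y' hyy
  have e : ((ρ (u (Multiplicative.ofAdd (y - y'))) : GL (Fin N) k) : Matrix (Fin N) (Fin N) k) *ᵥ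
      h.z0 = h.z0 := by
    have := congrArg (fun w => ((ρ (u (Multiplicative.ofAdd (-y'))) : GL (Fin N) k) :
      Matrix (Fin N) (Fin N) k) *ᵥ w) hyy
    simp only [orbitCurve, ← rho_mul_mulVec, ← map_mul, ← ofAdd_add] at this
    rw [neg_add_cancel, ofAdd_zero, map_one, map_one, Units.val_one, Matrix.one_mulVec] at this
    rw [sub_eq_add_neg, add_comm]
    exact this
  exact sub_eq_zero.1 (h.eq_zero_of_rho_uval_fix e)

/-- The orbit curve lies in the slice (`U_α` fixes the weight-`M_∞` coordinates of `z₀`). [folklore] -/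
theorem orbitCurve_mem_slice [IsAlgClosed k] (y : k) : h.orbitCurve y ∈ h.slice := by
  haveI : IsMulCommutative ↥T := h.torus.2.1
  obtain ⟨γ, hd⟩ := h.exists_cochar_pos
  refine ⟨rho_mulVec_mem _ h.z0_mem, ?_⟩
  rw [orbitCurve, h.rho_uval_mulVec_apply hd (fun j hj => h.wtInt_eq_Mz hj) y h.i0
    (h.wtInt_eq_Mz h.z0_i0).le, if_pos (h.wtInt_eq_Mz h.z0_i0)]

/-- The coordinates of the orbit curve are polynomials in `y`. [folklore] -/
theorem exists_polynomial_orbitCurve :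
    ∃ q : Fin N → Polynomial k, ∀ y i, (q i).eval y = h.orbitCurve y i := by
  choose q hq using h.exists_polynomial_rho_uval
  refine ⟨fun i => ∑ j, q i j * Polynomial.C (h.z0 j), fun y i => ?_⟩
  rw [orbitCurve, Matrix.mulVec, dotProduct, Polynomial.eval_finsetSum]
  exact Finset.sum_congr rfl fun j _ => by rw [Polynomial.eval_mul, Polynomial.eval_C, hq]

/-- **The orbit curve `U · z₀` is closed** (`isClosed_range_polyCurve`; it is non-constant, being
injective). [folklore] -/
theorem isClosed_range_orbitCurve [IsAlgClosed k] : IsClosed (Set.range h.orbitCurve) := by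
  obtain ⟨q, hq⟩ := h.exists_polynomial_orbitCurve
  have hq' : ∃ i, 0 < (q i).natDegree := by
    by_contra hcon
    push Not at hcon
    have : h.orbitCurve 0 = h.orbitCurve 1 := by
      funext i
      rw [← hq, ← hq, Polynomial.eq_C_of_natDegree_le_zero (hcon i), Polynomial.eval_C,
        Polynomial.eval_C]
    exact zero_ne_one (h.orbitCurve_injective this)
  have e : Set.range h.orbitCurve = Set.range fun y : k => fun i => (q i).eval y := by
    ext w; constructor <;> rintro ⟨y, rfl⟩ <;> exact ⟨y, funext fun i => by simp only [hq]⟩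
  rw [e]
  exact isClosed_range_polyCurve q hq'

/-- **The top coordinate takes infinitely many values on the orbit curve**: `(ρ(u(y)) z₀)(j₀)` is a
polynomial in `y` vanishing at `y = 0` (`z₀` has no weight-`M₀` coordinate) and non-zero for
`y ≠ 0` (the weight-`M₀` part of a point of the cone off the line `k z₀` is a non-zero multiple
of `v`, `exists_high_coords`). [cite: SpringerLAG1998, 7.1.5 (proof)] -/
theorem infinite_image_orbitCurve [IsAlgClosed k] :
    ((fun w : Fin N → k => MvPolynomial.eval w (MvPolynomial.X h.j0)) '' Set.range h.orbitCurve).Infinite := by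
  classical
  haveI : IsMulCommutative ↥T := h.torus.2.1
  obtain ⟨γ, hd⟩ := h.exists_cochar_pos
  obtain ⟨q, hq⟩ := h.exists_polynomial_orbitCurve
  -- the coordinate `j₀` along the curve
  have hzj : h.z0 h.j0 = 0 := by
    by_contra hzj
    exact absurd ((h.wtInt_eq_Mv (γ := γ) h.v_j0).symm.trans (h.wtInt_eq_Mz hzj))
      (ne_of_gt (h.Mz_lt_Mv hd))
  have h0 : (q h.j0).eval 0 = 0 := by
    rw [hq, orbitCurve, ofAdd_zero, map_one, map_one, Units.val_one, Matrix.one_mulVec, hzj]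
  have hne : ∀ y ≠ 0, (q h.j0).eval y ≠ 0 := by
    intro y hy
    have hw : h.orbitCurve y ∈ orbitCone ρ.range v := (h.orbitCurve_mem_slice y).1
    have hw0 : h.orbitCurve y ≠ 0 := (h.not_smul_v_of_mem_slice (h.orbitCurve_mem_slice y)).1
    have hnz : ¬ ∃ c : k, h.orbitCurve y = c • h.z0 := by
      rintro ⟨c, hc⟩
      have hc1 : c = 1 := by
        have := congrFun hc h.i0
        rw [(h.orbitCurve_mem_slice y).2, Pi.smul_apply, smul_eq_mul] at this
        have := mul_right_cancel₀ h.z0_i0 (this.symm.trans (one_mul _).symm)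
        exact this
      rw [hc1, one_smul] at hc
      have h00 : h.orbitCurve 0 = h.z0 := by
        rw [orbitCurve, ofAdd_zero, map_one, map_one, Units.val_one, Matrix.one_mulVec]
      exact hy (h.orbitCurve_injective (hc.trans h00.symm))
    obtain ⟨c, hc, hhigh⟩ := h.exists_high_coords hd hw hw0 hnz
    rw [hq, hhigh h.j0 (h.wtInt_eq_Mv h.v_j0)]
    exact mul_ne_zero hc h.v_j0
  -- a polynomial vanishing at `0` and nowhere else on `kˣ`... takes infinitely many values
  have himage : (fun w : Fin N → k => MvPolynomial.eval w (MvPolynomial.X h.j0)) '' Set.range h.orbitCurve =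
      Set.range fun y : k => (q h.j0).eval y := by
    ext c
    simp only [Set.mem_image, Set.mem_range, MvPolynomial.eval_X]
    constructor
    · rintro ⟨_, ⟨y, rfl⟩, rfl⟩; exact ⟨y, hq y h.j0⟩
    · rintro ⟨y, rfl⟩; exact ⟨_, ⟨y, rfl⟩, (hq y h.j0).symm⟩
  rw [himage]
  intro hfin
  -- finitely many values `c`, each with finitely many preimages (the polynomial is non-constant)
  have hq0 : q h.j0 ≠ Polynomial.C ((q h.j0).eval 1) := by
    intro e
    have := hne 1 one_ne_zero
    rw [e, Polynomial.eval_C] at h0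
    exact this h0
  have hcover : (Set.univ : Set k) ⊆ ⋃ c ∈ hfin.toFinset, {y : k | (q h.j0).eval y = c} := by
    intro y _
    simp only [Set.mem_iUnion, Set.mem_setOf_eq, Set.Finite.mem_toFinset, Set.mem_range,
      exists_prop]
    exact ⟨_, ⟨y, rfl⟩, rfl⟩
  have hfin' : (Set.univ : Set k).Finite := by
    refine Set.Finite.subset (Set.Finite.biUnion hfin.toFinset.finite_toSet fun c _ => ?_) hcover
    -- roots of `q - C c`
    have hqc : q h.j0 - Polynomial.C c ≠ 0 := by
      intro e
      rw [sub_eq_zero] at e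
      apply hq0
      rw [e, Polynomial.eval_C]
    refine ((q h.j0 - Polynomial.C c).roots.toFinset.finite_toSet).subset fun y hy => ?_
    have hy' : (q h.j0).eval y = c := hy
    simp only [Finset.mem_coe, Multiset.mem_toFinset, Polynomial.mem_roots hqc, Polynomial.IsRoot.def,
      Polynomial.eval_sub, Polynomial.eval_C, hy', sub_self]
  exact Set.infinite_univ hfin'

/-- **`X ∖ {x₀} = U · x_∞`**: the slice equals the orbit curve (the curve criterion
`eq_of_isClosed_of_infinite_image`: the slice is closed and irreducible with finite fibres of the
coordinate `j₀`, and contains the closed curve `U · z₀` on which `j₀` takes infinitely many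
values); the `k`-points content of Springer 7.2.2, proof (via 7.1.2 and 7.1.5: `G/B ≅ ℙ¹` and
`U ∩ n B n⁻¹ = {e}`, so `U n x₀` is the complement of `x₀`). [cite: SpringerLAG1998, 7.2.2 (proof)] -/
theorem range_orbitCurve_eq_slice [IsAlgClosed k] : Set.range h.orbitCurve = h.slice :=
  eq_of_isClosed_of_infinite_image h.isClosed_slice h.isIrreducible_slice (MvPolynomial.X h.j0)
    (fun c => by simpa only [MvPolynomial.eval_X] using h.finite_fibre c)
    h.isClosed_range_orbitCurve (by rintro _ ⟨y, rfl⟩; exact h.orbitCurve_mem_slice y)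
    h.infinite_image_orbitCurve

/-- **The Bruhat decomposition in semisimple rank one** (Springer 7.2.2 (i): "*`G` is the disjoint
union of `B` and `U n B`*"): every `g ∈ G ∖ B` is `u(x) m t u(y)`. From the data: `ρ(g) v` lies in
the orbit cone off the line `k v`, so after normalising its `i₀`-coordinate it lies in the slice,
i.e. equals `ρ(u(y) m) v` up to the scalar; hence `(u(y) m)⁻¹ g` stabilises the line of `v` and lies
in `B = T U_α`. [cite: SpringerLAG1998, 7.2.2 (i)] -/
theorem bruhat [IsAlgClosed k] {g : GL n k} (hg : g ∈ G) (hgB : g ∉ T ⊔ u.range.map G.subtype) :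
    ∃ (x y : k) (t : ↥T), g = uval u x * m * (t : GL n k) * uval u y := by
  haveI : IsMulCommutative ↥T := h.torus.2.1
  obtain ⟨γ, hd⟩ := h.exists_cochar_pos
  set w := ((ρ ⟨g, hg⟩ : GL (Fin N) k) : Matrix (Fin N) (Fin N) k) *ᵥ v with hw
  have hwC : w ∈ orbitCone ρ.range v := rho_mulVec_mem _ v_mem
  have hw0 : w ≠ 0 := by
    intro h0
    apply h.ne_zero
    have := congrArg (fun z => (((ρ ⟨g, hg⟩ : GL (Fin N) k)⁻¹ : GL (Fin N) k) :
      Matrix (Fin N) (Fin N) k) *ᵥ z) h0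
    simpa [hw, Matrix.mulVec_mulVec, ← Units.val_mul] using this
  have hnv : ¬ ∃ c : k, w = c • v := fun hc => hgB ((h.stab_iff ⟨g, hg⟩).1 hc)
  obtain ⟨c, hc, hlow⟩ := h.exists_low_coords hd hwC hw0 hnv
  set a := h.z0 h.i0 with ha
  have hF : w h.i0 = c * a := hlow h.i0 (h.wtInt_eq_Mz h.z0_i0)
  have hF0 : w h.i0 ≠ 0 := by rw [hF]; exact mul_ne_zero hc h.z0_i0
  -- normalise into the slice
  have hmem : c⁻¹ • w ∈ h.slice := by
    refine ⟨isConeSet_orbitCone _ (inv_ne_zero hc) _ hwC, ?_⟩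
    rw [Pi.smul_apply, smul_eq_mul, hF, inv_mul_cancel_left₀ hc]
  rw [← h.range_orbitCurve_eq_slice] at hmem
  obtain ⟨y, hy⟩ := hmem
  -- `ρ((u(y) m)⁻¹ g) v = c v`
  have key : ∃ c' : k, ((ρ ((u (Multiplicative.ofAdd y) * ⟨m, h.memG⟩)⁻¹ * ⟨g, hg⟩) : GL (Fin N) k) :
      Matrix (Fin N) (Fin N) k) *ᵥ v = c' • v := by
    refine ⟨c, ?_⟩
    rw [rho_mul_mulVec, ← hw, show w = c • h.orbitCurve y by
      rw [hy, smul_smul, mul_inv_cancel₀ hc, one_smul], Matrix.mulVec_smul, orbitCurve, z0,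
      ← rho_mul_mulVec, ← rho_mul_mulVec, mul_assoc, inv_mul_cancel, map_one, Units.val_one,
      Matrix.one_mulVec]
  have hb := (h.stab_iff _).1 key
  obtain ⟨t, ht, x, e⟩ := h.rootHom.mem_sup_iff.1 hb
  refine ⟨y, x, ⟨t, ht⟩, ?_⟩
  have e' : (uval u y * m)⁻¹ * g = t * uval u x := by
    simpa [uval] using e
  calc g = uval u y * m * ((uval u y * m)⁻¹ * g) := by group
    _ = uval u y * m * (t * uval u x) := by rw [e']
    _ = uval u y * m * t * uval u x := by group

end RankOneOrbitData

end Bruhat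

/-! ### Producing the data from Chevalley's theorem 5.5.3 and the closed-orbit fact -/

section Existence

/-- Conjugating the target of an algebraic homomorphism by a fixed matrix keeps it algebraic
(Springer 2.1.2: `Int(P)` is a morphism). [folklore] -/
theorem MonoidHom.IsAlgebraicGL.conj_comp {G : Subgroup (GL n k)} {N : ℕ} {ρ : ↥G →* GL (Fin N) k}
    (hρ : MonoidHom.IsAlgebraicGL ρ) (P : GL (Fin N) k) :
    MonoidHom.IsAlgebraicGL ((MulAut.conj P).toMonoidHom.comp ρ) := by
  obtain ⟨Pρ, hPρ⟩ := hρ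
  refine ⟨fun c => MvPolynomial.bind₁ Pρ (conjPolyGL P P⁻¹ c), fun g c => ?_⟩
  rw [eval_bind₁', show (fun i => MvPolynomial.eval (glCoordFun (g : GL n k)) (Pρ i)) =
    glCoordFun (ρ g) from funext fun i => (hPρ g i).symm, eval_conjPolyGL]
  rfl

/-- **Existence of the rank-one orbit data** from: Chevalley's theorem 5.5.3
(`exists_isAlgebraicGL_lineStabilizer_eq`, for the algebraic subgroup `B = T · U_α`),
simultaneous diagonalisation of the commuting semisimple family `ρ(T)`
(`exists_conj_le_diagonalSubgroup`), the fact `Z_G(T) = T` (`centralizer_eq_of_isMaximalTorusIn`,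
7.6.4 (ii)) and the closed-orbit fact `isClosed_orbitCone_of_borel_le_lineStabilizer` (6.2.7 (ii)).
[cite: SpringerLAG1998, 7.1.5 (proof)] -/
theorem exists_rankOneOrbitData [IsAlgClosed k]
    (hF₃ : centralizer_eq_of_isMaximalTorusIn (k := k) (n := n))
    (hOrb : isClosed_orbitCone_of_borel_le_lineStabilizer (k := k) (n := n))
    {G T : Subgroup (GL n k)} (hG : IsConnectedReductive G) (hT : IsMaximalTorusIn T G)
    {α : ↥(characterLattice T)} (hα : α ∈ roots G T)
    (hcen : G ≤ Subgroup.centralizer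
      ((identityComponent ((α : ↥T →* kˣ).ker.map T.subtype) : Subgroup (GL n k)) : Set (GL n k)))
    {u : Multiplicative k →* ↥G} (hu : IsRootHom G T hT.1 (α : ↥T →* kˣ) u)
    (hB : IsBorelIn (T ⊔ u.range.map G.subtype) G)
    {m : GL n k} (hmG : m ∈ G) (hmN : m ∈ Subgroup.normalizer (T : Set (GL n k)))
    (hmZ : m ∉ Subgroup.centralizer (T : Set (GL n k))) :
    ∃ (N : ℕ) (ρ : ↥G →* GL (Fin N) k) (v : Fin N → k), RankOneOrbitData G T α u m ρ v := by
  classical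
  have hTtorus : IsTorusSubgroup T := hT.2.1
  haveI : IsMulCommutative ↥T := hTtorus.2.1
  -- Chevalley 5.5.3 for `B`
  obtain ⟨N, ρ, v, hρ, hv0, hstab⟩ :=
    exists_isAlgebraicGL_lineStabilizer_eq (H := T ⊔ u.range.map G.subtype) G hB.2.1.1
  -- diagonalise `ρ(T)`
  set Tρ : Subgroup (GL (Fin N) k) := (T.subgroupOf G).map ρ with hTρ
  have hmemTρ : ∀ {x : GL (Fin N) k}, x ∈ Tρ ↔ ∃ g : ↥G, (g : GL n k) ∈ T ∧ ρ g = x := by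
    intro x
    simp only [hTρ, Subgroup.mem_map, Subgroup.mem_subgroupOf]
  have hcommρ : IsMulCommutative ↥Tρ := by
    refine ⟨⟨fun a b => Subtype.ext ?_⟩⟩
    obtain ⟨g, hg, hga⟩ := hmemTρ.1 a.2
    obtain ⟨g', hg', hgb⟩ := hmemTρ.1 b.2
    rw [Subgroup.coe_mul, Subgroup.coe_mul, ← hga, ← hgb, ← map_mul, ← map_mul]
    congr 1
    exact Subtype.ext (by
      have := congrArg Subtype.val (mul_comm (⟨(g : GL n k), hg⟩ : ↥T) ⟨(g' : GL n k), hg'⟩)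
      simpa using this)
  have hssρ : ∀ x ∈ Tρ, IsSemisimpleElt x := by
    intro x hx
    obtain ⟨g, hg, rfl⟩ := hmemTρ.1 hx
    have := IsSemisimpleElt.map_of_isAlgebraicGL hρ g.2 (hTtorus.2.2 _ hg)
    exact this
  obtain ⟨P, hP⟩ := exists_conj_le_diagonalSubgroup hcommρ hssρ
  -- the conjugated data
  set ρ' : ↥G →* GL (Fin N) k := (MulAut.conj P).toMonoidHom.comp ρ with hρ'
  set v' : Fin N → k := ((P : GL (Fin N) k) : Matrix (Fin N) (Fin N) k) *ᵥ v with hv'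
  have hρ'apply : ∀ g : ↥G, ((ρ' g : GL (Fin N) k) : Matrix (Fin N) (Fin N) k) =
      (P : Matrix (Fin N) (Fin N) k) * (ρ g : Matrix (Fin N) (Fin N) k) *
        ((P⁻¹ : GL (Fin N) k) : Matrix (Fin N) (Fin N) k) := by
    intro g
    simp [hρ', MulAut.conj_apply]
  have hstab' : ∀ g : ↥G, (∃ c : k, ((ρ' g : GL (Fin N) k) : Matrix (Fin N) (Fin N) k) *ᵥ v' = c • v') ↔
      (g : GL n k) ∈ T ⊔ u.range.map G.subtype := by
    intro g
    rw [← hstab g, hρ'apply, hv']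
    have hPP : ((P⁻¹ : GL (Fin N) k) : Matrix (Fin N) (Fin N) k) * (P : Matrix (Fin N) (Fin N) k) = 1 := by
      rw [← Units.val_mul, inv_mul_cancel, Units.val_one]
    constructor
    · rintro ⟨c, hc⟩
      refine ⟨c, ?_⟩
      rw [Matrix.mulVec_mulVec, mul_assoc, hPP, mul_one] at hc
      have := congrArg (fun w => ((P⁻¹ : GL (Fin N) k) : Matrix (Fin N) (Fin N) k) *ᵥ w) hc
      rwa [Matrix.mulVec_mulVec, ← mul_assoc, hPP, one_mul, Matrix.mulVec_smul, Matrix.mulVec_mulVec,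
        hPP, Matrix.one_mulVec] at this
    · rintro ⟨c, hc⟩
      refine ⟨c, ?_⟩
      rw [Matrix.mulVec_mulVec, mul_assoc, hPP, mul_one, ← Matrix.mulVec_mulVec, hc,
        Matrix.mulVec_smul]
  refine ⟨N, ρ', v', {
    conn := hG.1
    maxTorus := hT
    mem_roots := hα
    central := hcen
    rootHom := hu
    borel := hB
    centralizer_eq := hF₃ hG hT
    memG := hmG
    memN := hmN
    notMemZ := hmZ
    algebraic := hρ.conj_comp P
    ne_zero := ?_
    stab_iff := hstab'
    diag := ?_
    closed := ?_ }⟩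
  · intro h0
    apply hv0
    have := congrArg (fun w => ((P⁻¹ : GL (Fin N) k) : Matrix (Fin N) (Fin N) k) *ᵥ w) h0
    simpa [hv', Matrix.mulVec_mulVec, ← Units.val_mul] using this
  · intro t
    have hmem : ρ' ⟨t, hT.1 t.2⟩ ∈ Tρ.map (MulAut.conj P).toMonoidHom :=
      Subgroup.mem_map_of_mem _ (hmemTρ.2 ⟨⟨t, hT.1 t.2⟩, t.2, rfl⟩)
    obtain ⟨d, hd⟩ := hP hmem
    refine ⟨fun i => (d i : k), ?_⟩
    rw [← hd, coe_diagonalGL]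
  · exact hOrb hG.1 hB ρ' (hρ.conj_comp P) v' fun b hb => (hstab' b).2 hb

/-- **The Bruhat decomposition of a connected reductive group of semisimple rank one, from the
Borel-subgroup facts** (Springer 7.2.2 (i) on `k`-points): given `Z_G(T) = T` (7.6.4 (ii)) and the
closed-orbit fact (6.2.7 (ii)), if `B = T · U_α` is a Borel subgroup and `m ∈ N_G(T) ∖ Z_G(T)`,
then `G = B ∪ U_α m B`. [cite: SpringerLAG1998, 7.2.2 (i)] -/
theorem bruhat_of_isBorelIn [IsAlgClosed k]
    (hF₃ : centralizer_eq_of_isMaximalTorusIn (k := k) (n := n))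
    (hOrb : isClosed_orbitCone_of_borel_le_lineStabilizer (k := k) (n := n))
    {G T : Subgroup (GL n k)} (hG : IsConnectedReductive G) (hT : IsMaximalTorusIn T G)
    {α : ↥(characterLattice T)} (hα : α ∈ roots G T)
    (hcen : G ≤ Subgroup.centralizer
      ((identityComponent ((α : ↥T →* kˣ).ker.map T.subtype) : Subgroup (GL n k)) : Set (GL n k)))
    {u : Multiplicative k →* ↥G} (hu : IsRootHom G T hT.1 (α : ↥T →* kˣ) u)
    (hB : IsBorelIn (T ⊔ u.range.map G.subtype) G)
    {m : GL n k} (hmG : m ∈ G) (hmN : m ∈ Subgroup.normalizer (T : Set (GL n k)))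
    (hmZ : m ∉ Subgroup.centralizer (T : Set (GL n k)))
    {g : GL n k} (hg : g ∈ G) (hgB : g ∉ T ⊔ u.range.map G.subtype) :
    ∃ (x y : k) (t : ↥T), g = uval u x * m * (t : GL n k) * uval u y := by
  obtain ⟨N, ρ, v, h⟩ := exists_rankOneOrbitData hF₃ hOrb hG hT hα hcen hu hB hmG hmN hmZ
  exact h.bruhat hg hgB

end Existence

end Literature.NumberTheory.Automorphic
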